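import Summits.ABC.IUTFork.ForkGenuineMinLawPilot
import Literature.IUT.LogVolume.RescaledCompletionInvariants
import HarnessLib

/-!
# The fork at [IUTchIII] Corollary 3.12 at a GENUINE input: at an absolutely unramified completion the BASE place is unramified too
# (`e_v = 1`), so the E-MIN law reads directly on the Θ-pilot divisor (skeleton XXVIIf-c)

Record-only file (D-0012) of the abc-iut cell (deliverable (a), skeleton seat abc-iut-skel, gen 9); TAKES NO SIDE.
Sequel to `ForkGenuineMinLawPilot.lean` (XXVIIf-b, p449036: `negLogThetaLoc I p = (1/ℓ⋇)·Σ_i Σ_{v⃗} (−min_b (P_{Θ,i}(v_b)/e_{v_b})·log p)·Π Pr`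
with the ramification indices `e_v` of the BASE places kept symbolic). HERE the symbol is removed: if the genuine completion `K_{v̲}` (`v̲ = σ(v)`)
is absolutely unramified then so is `F₀,v`, i.e. `e_v = 1` — Mathlib's tower divisibility `e(v|p) ∣ e(v̲|p)` (`Ideal.ramificationIdx_below_dvd`,
flatness of `𝓞_K` over `𝓞_{F₀}`) through abc-iut-S7's `absRamificationIdx_rescaledCompletion` and the identification of the tree's `ramIdx`
(`Ideal.ramificationIdx'` spelling) with Mathlib's `Ideal.ramificationIdx`:

* `ramIdx_eq_ramificationIdx` — `ramIdx F v = v.ramificationIdx ℤ`; **`ramIdx_eq_one_of_absRamificationIdx_eq_one`** — `e(K_{v̲}/ℚ_p) = 1 ⇒ e_v = 1`;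
* **`negLogThetaLoc_eq_min_thetaPilot_of_unramified'`** — at an odd prime with all `σ`-completions absolutely unramified (e.g. `p ∤ disc K`), for
  ANY input: `negLogThetaLoc I p = (1/ℓ⋇)·Σ_i Σ_{v⃗ ∈ 𝕍_p^{i+2}} (−min_b P_{Θ,i}(v_b)·log p)·Π_b Pr(v_b)` with `P_{Θ,i}(v) = (i+1)²·ord_v(q_v)/(2l)` on `S`,
  `0` off `S` — the typed Θ-side summand as a closed function of the printed pilot divisor and the weights;
* **`negLogThetaLoc_eq_bare_iff_qPilot'`** — typed summand = bare value `ln ν̄(O_𝕃(−P_Θ)_p)` IFF `P_q` is CONSTANT on the places over `p`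
  (equivalently: no bad place over `p`, or all places over `p` bad with one value of `ord_v(q_v)`);
* `negAbsLogQAt_tΘ_eq_thetaPilot'` — the bare value `= (1/ℓ⋇)·Σ_i Σ_{v⃗} (−P_{Θ,i}(v_last)·log p)·Π Pr = −((l+1)(l−1)... )` kept as the sum.

READING (grammar of `HOME/skel/FORK-REAL-MODEL.md` §12–§13; no side taken): the `type(v) = unram-odd` cells of a genuine-data table need no
numerics for the typed Θ-side summand — it is the E-min functional of the printed `q`-orders and weights; inflation there is (Ind1) mixing,
present exactly when the `q`-orders over `p` differ (or bad and good places share `p`). HONEST SCOPE: statements about OUR typed numbers for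
every inhabitant of abc-iut-S2's input type; which primes of given initial Θ-data are of this type is data. Nothing here bears on whether
[IUTchIII] Thm. 3.11 licenses Cor. 3.12; typed ≠ proved. PROOF-ONLY file: no definitions, no `Prop` facts.
[cite: NeukirchANT1999, Ch. II Prop. (8.5), Ch. III Cor. (2.12)] [cite: Mochizuki2012, IUTchIV Thm. 1.10 Step (v)–(vi) p. 27–29]
[cite: DupuyHilado2025, §2.4.2, §3.3, §4.7, §4.11–4.12] [cite: Mochizuki2012, IUTchIII Cor. 3.12 p. 173–174] [claim: Mochizuki2012, status: disputed]
-/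

noncomputable section

open Set Module Literature.IUT.LogVolume Literature.NumberTheory.NumberFields NumberField IsDedekindDomain
open scoped Pointwise

namespace Summit.ABC.IUTFork.GenuineContent

section Unram

variable {F₀ : Type} [Field F₀] [NumberField F₀] {K : Type} [Field K] [NumberField K] [Algebra F₀ K]

/-- The tree's `ramIdx F v` (`Ideal.ramificationIdx'` spelling of abc-iut-c312-3's `FakeAdeleIndex`) IS Mathlib's `v.ramificationIdx ℤ`.
[cite: NeukirchANT1999, Ch. II Prop. (8.5)] -/
theorem ramIdx_eq_ramificationIdx (v : HeightOneSpectrum (𝓞 F₀)) : ramIdx F₀ v = v.asIdeal.ramificationIdx ℤ := by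
  unfold ramIdx
  have hp : Ideal.span {(residueChar F₀ v : ℤ)} ≠ ⊥ := by
    simp [(residueChar_prime F₀ v).ne_zero]
  rw [Ideal.ramificationIdx'_eq_ramificationIdx _ _ hp]

/-- **An absolutely unramified genuine completion sits over an unramified base place**: `e(K_{v̲}/ℚ_p) = 1 ⇒ e_v = e(v|p) = 1`
(`e(v|p) ∣ e(v̲|p)` in the tower `ℤ → 𝓞_{F₀} → 𝓞_K`; abc-iut-S7's `absRamificationIdx_rescaledCompletion`). [cite: NeukirchANT1999, Ch. II Prop. (8.5)] -/
theorem ramIdx_eq_one_of_absRamificationIdx_eq_one (σ : PlaceSection F₀ K) (p : ℕ) [hp : Fact p.Prime] (v : placesOver F₀ p)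
    (he : absRamificationIdx p ((σ.localFieldFamily p hp.out).k v) = 1) : ramIdx F₀ v.1 = 1 := by
  have h1 : (σ.lift v.1).asIdeal.ramificationIdx ℤ = 1 := by
    rw [← absRamificationIdx_rescaledCompletion K p (σ.lift v.1) (σ.natCast_mem_lift v)]
    exact he
  haveI := σ.liesOver_lift v.1
  have hdvd := Ideal.ramificationIdx_below_dvd (R := ℤ) v.1.asIdeal (σ.lift v.1).asIdeal
  rw [h1, Nat.dvd_one] at hdvd
  rw [ramIdx_eq_ramificationIdx, hdvd]

variable (I : ThetaVolumeInput F₀ K) (p : ℕ) [hp : Fact p.Prime]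

/-- **THE E-MIN LAW ON THE Θ-PILOT DIVISOR**: for every input `I` and every ODD prime `p` at which all `σ`-completions are absolutely unramified,
`negLogThetaLoc I p = (1/ℓ⋇)·Σ_i Σ_{v⃗ ∈ 𝕍_p^{i+2}} (−min_b P_{Θ,i}(v_b)·log p)·Π_b Pr(v_b)`. HYPOTHESIS-free evaluation of OUR typed number; no side taken.
[cite: Mochizuki2012, IUTchIV Prop. 1.2 (iv) p. 11, Thm. 1.10 Step (vi) p. 29] [cite: DupuyHilado2025, §3.3, Def. 3.6.3, §4.7, §4.11–4.12]
[claim: Mochizuki2012, status: disputed] -/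
theorem negLogThetaLoc_eq_min_thetaPilot_of_unramified' (hp2 : 2 < p)
    (he : ∀ v : placesOver F₀ p, absRamificationIdx p ((I.σ.localFieldFamily p hp.out).k v) = 1) :
    I.negLogThetaLoc p =
      (1 / (I.lstar : ℝ)) * ∑ i : Fin I.lstar, ∑ e : Fin ((i : ℕ) + 1 + 1) → placesOver F₀ p,
        -((Finset.univ.inf' Finset.univ_nonempty fun b => I.X.thetaPilot i (e b).1) * Real.log p) *
          ∏ b, weight F₀ (e b).1 := by
  rw [negLogThetaLoc_eq_min_thetaPilot_of_unramified I p hp2 he]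
  refine congrArg (fun x : ℝ => (1 / (I.lstar : ℝ)) * x)
    (Finset.sum_congr rfl fun i _ => Finset.sum_congr rfl fun e _ => ?_)
  rw [show (fun b => I.X.thetaPilot i (e b).1 / ramIdx F₀ (e b).1) = fun b => I.X.thetaPilot i (e b).1 from
    funext fun b => by rw [ramIdx_eq_one_of_absRamificationIdx_eq_one I.σ p (e b) (he (e b)), Nat.cast_one, div_one]]

/-- **The same under `p ∤ disc K`.** [cite: NeukirchANT1999, Ch. III Cor. (2.12)] [cite: Mochizuki2012, IUTchIV Thm. 1.10 Step (vi) p. 29]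
[claim: Mochizuki2012, status: disputed] -/
theorem negLogThetaLoc_eq_min_thetaPilot_of_not_dvd_discr' (hp2 : 2 < p) (hdisc : ¬ (p : ℤ) ∣ NumberField.discr K) :
    I.negLogThetaLoc p =
      (1 / (I.lstar : ℝ)) * ∑ i : Fin I.lstar, ∑ e : Fin ((i : ℕ) + 1 + 1) → placesOver F₀ p,
        -((Finset.univ.inf' Finset.univ_nonempty fun b => I.X.thetaPilot i (e b).1) * Real.log p) *
          ∏ b, weight F₀ (e b).1 :=
  negLogThetaLoc_eq_min_thetaPilot_of_unramified' I p hp2 fun v => I.σ.absRamificationIdx_localFieldFamily_eq_one hdisc v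

/-- **The BARE value on the Θ-pilot divisor**: `ln ν̄(O_𝕃(−P_Θ)_p) = (1/ℓ⋇)·Σ_i Σ_{v⃗} (−P_{Θ,i}(v_last)·log p)·Π Pr` at such a prime.
[cite: DupuyHilado2025, §3.9, Thm. 3.10.1] -/
theorem negAbsLogQAt_tΘ_eq_thetaPilot'
    (he : ∀ v : placesOver F₀ p, absRamificationIdx p ((I.σ.localFieldFamily p hp.out).k v) = 1) :
    (I.packetAt p hp.out).negAbsLogQAt I.lstar (I.tΘ p hp.out) =
      (1 / (I.lstar : ℝ)) * ∑ i : Fin I.lstar, ∑ e : Fin ((i : ℕ) + 1 + 1) → placesOver F₀ p,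
        -(I.X.thetaPilot i (e (Fin.last ((i : ℕ) + 1))).1 * Real.log p) * ∏ b, weight F₀ (e b).1 := by
  rw [negAbsLogQAt_tΘ_eq_thetaPilot I p he]
  refine congrArg (fun x : ℝ => (1 / (I.lstar : ℝ)) * x)
    (Finset.sum_congr rfl fun i _ => Finset.sum_congr rfl fun e _ => ?_)
  rw [ramIdx_eq_one_of_absRamificationIdx_eq_one I.σ p _ (he _), Nat.cast_one, div_one]

/-- **NO INFLATION IFF THE `q`-PILOT IS CONSTANT OVER `p`**: at an odd prime with all `σ`-completions absolutely unramified,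
`negLogThetaLoc I p = ln ν̄(O_𝕃(−P_Θ)_p)` iff `P_q(v) = ord_v(q_v)/(2l)·[v ∈ S]` takes ONE value on the places over `p`.
[cite: Mochizuki2012, IUTchIV Thm. 1.10 Step (v)–(vi) p. 27–29] [cite: DupuyHilado2025, §3.3, §4.7] [claim: Mochizuki2012, status: disputed] -/
theorem negLogThetaLoc_eq_bare_iff_qPilot' (hp2 : 2 < p)
    (he : ∀ v : placesOver F₀ p, absRamificationIdx p ((I.σ.localFieldFamily p hp.out).k v) = 1) :
    I.negLogThetaLoc p = (I.packetAt p hp.out).negAbsLogQAt I.lstar (I.tΘ p hp.out) ↔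
      ∀ v w : placesOver F₀ p, I.X.qPilot v.1 = I.X.qPilot w.1 := by
  rw [negLogThetaLoc_eq_bare_iff_qPilot I p hp2 he]
  refine forall_congr' fun v => forall_congr' fun w => ?_
  rw [ramIdx_eq_one_of_absRamificationIdx_eq_one I.σ p v (he v), ramIdx_eq_one_of_absRamificationIdx_eq_one I.σ p w (he w),
    Nat.cast_one, div_one, div_one]

/-- **Equal `q`-orders at ALL-BAD places over `p` ⇒ no inflation; a single differing order ⇒ STRICT inflation** — the second clause:
two bad places over the same unramified odd prime with `ord_v(q_v) ≠ ord_w(q_w)` force `ln ν̄(O_𝕃(−P_Θ)_p) < negLogThetaLoc I p`.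
[cite: Mochizuki2012, IUTchIV Thm. 1.10 Step (v)–(vi) p. 27–29] [claim: Mochizuki2012, status: disputed] -/
theorem negLogThetaLoc_gt_bare_of_ordq_ne (hp2 : 2 < p)
    (he : ∀ v : placesOver F₀ p, absRamificationIdx p ((I.σ.localFieldFamily p hp.out).k v) = 1)
    {v w : placesOver F₀ p} (hv : v.1 ∈ I.X.S) (hw : w.1 ∈ I.X.S) (hne : I.X.ordq v.1 ≠ I.X.ordq w.1) :
    (I.packetAt p hp.out).negAbsLogQAt I.lstar (I.tΘ p hp.out) < I.negLogThetaLoc p := by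
  obtain ⟨n, hn⟩ := exists_int_norms_tΘ_of_unramified I p he
  have hle : (I.packetAt p hp.out).negAbsLogQAt I.lstar (I.tΘ p hp.out) ≤ I.negLogThetaLoc p := by
    rw [I.negLogThetaLoc_of_prime hp.out]
    exact negAbsLogQAt_le_negLogThetaAt_of_unramified p (I.σ.localFieldFamily p hp.out)
      (mScale p (I.σ.localFieldFamily p hp.out)) (mScale_ne_zero p (I.σ.localFieldFamily p hp.out))
      (mScale_perm p (I.σ.localFieldFamily p hp.out)) hp2 he (I.tΘ p hp.out) n fun i v => (hn i v).1
  refine lt_of_le_of_ne hle fun heq => hne ?_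
  have hconst := (negLogThetaLoc_eq_bare_iff_qPilot' I p hp2 he).mp heq.symm v w
  rw [PilotData.qPilot_apply_of_mem I.X hv, PilotData.qPilot_apply_of_mem I.X hw] at hconst
  have hl : (0 : ℝ) < 2 * I.X.l := by have := I.X.five_le_l; positivity
  have h := (div_left_inj' hl.ne').mp hconst
  exact_mod_cast h

end Unram

end Summit.ABC.IUTFork.GenuineContent

end
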